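import Summits.BirchSwinnertonDyer.Rank1Residual.Additive.X4ExoticWildArms
import Summits.BirchSwinnertonDyer.Rank1Residual.Additive.X4MThreeUpperHalfTowerFree
import Summits.BirchSwinnertonDyer.Rank1Residual.GaloisImage.J1728NotSurjThree
import Summits.BirchSwinnertonDyer.Rank1Residual.GaloisImage.WildThreeAdicTowerTameTorsion
import HarnessLib

/-!
# The EXOTIC residue of X4 at `3` has WILD `3`-torsion at `3` — the `3`-adic tower on every X4 row
# whose `3`-division field is tamely ramified at `3` (cell `b2b-bsdres`, team n1011, seat p14 gen 3,
# OWNERS row T-b11 ARM B 'EXOTIC core at m = 3'; class side of `GaloisImage/WildThreeAdicTowerTameTorsion.lean`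
# p269787, written WITHOUT the import of `Additive/X4ExoticThree.lean` p268581 whose farm olean has been
# unavailable since 12:12Z — the `v₃(j − 1728) = 3` step is re-derived inside the proof, not re-declared)

HONEST FRAMING (cell `b2b-bsdres`, run/shared/lean/b2b/bsd-rank1-residual/, verbatim in every
file): the goal of the cell is to DELETE the COMBINATION-SHAPED residual classes of the
Birch–Swinnerton-Dyer formula for ALL analytic-rank `≤ 1` elliptic curves over `ℚ` — "full BSD
formula for every rank `≤ 1` curve in class `C`" assembled STRICTLY from published theorems — so
that the rank-`≤ 1` remainder becomes exactly the CONSTRUCTION-SHAPED classes, which are TYPED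
(missing-input `Prop`s), NOT attempted. This is not "finishing BSD". Team n1011 (N10 / N11, the
additive block X4 ∧ `p = 3`): research route; no claim beyond the stated classes; the label X4 is
UNCHANGED by this file; nothing is booked. Theorems only (no definition, no named fact minted; every
published input of the end-state is an explicit named-fact hypothesis, as in p250513 / p251574).

## What this file proves

Place data at `3` as in n1011-p02's inertia criterion (`v` the finite place of `ℚ` with
`primesEquiv v = 3`, `𝔓` the prime of `ℤ̄` cut out by `placeOver 3`, `I_𝔓 ≤ Γ_ℚ` its inertia group).

* **`ClassX4.towerSurj_three_of_surj_of_tameTorsion`** — X4 at `3`, `ρ̄_{E,3}` onto and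
  `3 ∤ #ρ̄_{E,3}(I_𝔓)` (the `3`-division field TAMELY ramified at `3`) ⟹ `ρ̄_{E,3ⁿ}` onto for
  every `n`, with NO hypothesis on `v₃(j − 1728)`.  Were the tower to fail: ARM A gives
  `v₃(j − 1728) ∈ {3, 0}` on the cell (w) (p264500 `ClassX4.exotic_arms_of_not_towerSurj_three`),
  `= 0` is excluded (the semistable-twist tower p249389 forces `j = 0 ∨ v₃ j > 0`, and `j = 1728` is
  impossible at surj(3), p267301 — so `v₃(j − 1728) ≥ 1`), hence `v₃(j − 1728) = 3`, and the
  tame-torsion tower at `m = 3` (p269787) restores the tower — contradiction.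
* `ClassX4.wildTorsion_of_not_towerSurj_three` — contrapositive: an EXOTIC row has
  `3 ∣ #ρ̄_{E,3}(I_𝔓)` for every such `𝔓` (WILD `3`-torsion at `3`).
* `exotic_iff_exotic_of_wildTorsion` and the END-STATE
  **`x4SharpUnitFree_iff_lower_and_residues_sharp_exoticWildTorsion_noL20`** — p251574's eight-fact
  X4 end-state with the EXOTIC piece quantified only over the rows with wild `3`-torsion at `3`
  (conjoin row by row with the restrictions of `X4ExoticThree` / `X4ExoticNotCubeRoot`).

Census reading (EVIDENCE, `HOME/b2b-bsdres-n1011-p14/e11/EXO3-LOCAL-WITNESS.md` §2): 25 of the 341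
`r_an = 0` EXOTIC-candidate cells (7 distinct `j`, all `f₃ = 3`, `j/3^{v₃ j} ≡ ±1 (mod 9)`) have
`[ℚ₃(x(E[3])) : ℚ₃] = 2`, hence tame `E[3]` at `3`: theorem rows by this file modulo the per-pair
tameness input.  Nothing booked; X4 CONSTRUCTION-SHAPED; no label change.

References: [SerreLocalFields1979] I §7; [SerreAbelianLadic1968] IV-23 Lemma 3; [Wuthrich2014]
Lemma 20; [Lang1987] Ch. 10 §4 Remark; [Elkies2006]; [Kato2004Asterisque] Thm. 14.5 (3).
-/

noncomputable section

open scoped Classical NumberField Pointwise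

open Field IsDedekindDomain WeierstrassCurve Rat.HeightOneSpectrum
  Literature.NumberTheory.EllipticCurves
  Literature.NumberTheory.EllipticCurves.ModularForms
  Literature.NumberTheory.EllipticCurves.Rank1Residual
  Literature.NumberTheory.EllipticCurves.Rank1Residual.Typed
  Literature.NumberTheory.GaloisRepresentations
  Summit.BirchSwinnertonDyer.Rank1Residual.GaloisImage

namespace Summit.BirchSwinnertonDyer.Rank1Residual.Additive

section WildTorsion

variable {W : WeierstrassCurve ℚ} [W.IsElliptic] [W.IsGloballyMinimal]

/-- **X4 at `3` ∧ surj(3) ∧ TAME `E[3]` at `3` ⟹ the whole `3`-adic tower** (no hypothesis on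
`v₃(j − 1728)`; see the module docstring for the chain p264500 → p249389 / p267301 → p269787).
[cite: SerreLocalFields1979, Ch. I §7 Cor. to Prop. 21 and Prop. 22(b)]
[cite: SerreAbelianLadic1968, Ch. IV §3.4, Lemma 3 (IV-23)] [cite: Lang1987, Ch. 10 §4, Remark] -/
theorem ClassX4.towerSurj_three_of_surj_of_tameTorsion [Fact (Nat.Prime 3)]
    (hX : ClassX4 W 3) (hsurj : Surj W 3)
    {v : HeightOneSpectrum (𝓞 ℚ)} (hv : (primesEquiv v : ℕ) = 3)
    {𝔓 : Ideal (absIntegers (𝓞 ℚ) ℚ)}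
    (hmem : ∀ x : absIntegers (𝓞 ℚ) ℚ, x ∈ 𝔓 ↔ (x : AlgebraicClosure ℚ) ∈ (placeOver 3).nonunits)
    (h𝔓 : 𝔓 ∈ v.primesAbove)
    (h3 : ¬ 3 ∣ Nat.card ((𝔓.inertia (absoluteGaloisGroup ℚ)).map (galoisRepTorsion W 3))) :
    ∀ n : ℕ, W.HasSurjectiveModNGaloisRep (3 ^ n : ℕ) := by
  by_contra hnot
  -- the EXOTIC signature after both arms of T-b10: `v₃(j − 1728) = 3 ∨ = 0`
  obtain ⟨_, h30, -⟩ := ClassX4.exotic_arms_of_not_towerSurj_three hX hsurj hnot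
  -- `v₃(j − 1728) ≥ 1`: `j = 0 ∨ v₃ j > 0` (p249389) and `j ≠ 1728` (p267301)
  have hj0 := ClassX4.j_eq_zero_or_padicValRat_j_pos_of_not_towerSurj hX hsurj hnot
  have h1728 : W.j ≠ 1728 := j_ne_1728_of_surj_three W hsurj
  have hpos : 0 < padicValRat 3 (W.j - 1728) := by
    have h1728v : padicValRat 3 (-1728 : ℚ) = 3 := by rw [padicValRat.neg, padicValRat_three_1728]
    rcases hj0 with h0 | hp
    · rw [h0, zero_sub, h1728v]; norm_num
    · have hne : W.j + (-1728) ≠ 0 := by rw [← sub_eq_add_neg]; exact sub_ne_zero.mpr h1728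
      have hmin := padicValRat.min_le_padicValRat_add (p := 3) hne
      rw [← sub_eq_add_neg] at hmin
      refine lt_of_lt_of_le (lt_min hp ?_) hmin
      rw [h1728v]; norm_num
  have hm : padicValRat 3 (W.j - 1728) = (3 : ℕ) := by
    rcases h30 with h | h
    · exact_mod_cast h
    · exfalso; rw [h] at hpos; exact lt_irrefl _ hpos
  exact hnot (towerSurj_three_of_surj_of_padicValRat_j_sub_eq_three_of_not_three_dvd W hm hsurj hv
    hmem h𝔓 h3)

/-- **An EXOTIC row has WILD `3`-torsion at `3`**: X4 at `3`, surj(3), tower failing ⟹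
`3 ∣ #ρ̄_{E,3}(I_𝔓)` at every prime `𝔓` of `ℤ̄` over `3` cut out by the place.
[cite: SerreLocalFields1979, Ch. I §7 Cor. to Prop. 21 and Prop. 22(b)] [cite: SerreAbelianLadic1968, Ch. IV §3.4, Lemma 3 (IV-23)] -/
theorem ClassX4.wildTorsion_of_not_towerSurj_three [Fact (Nat.Prime 3)]
    (hX : ClassX4 W 3) (hsurj : Surj W 3) (hnot : ¬ ∀ n : ℕ, W.HasSurjectiveModNGaloisRep (3 ^ n : ℕ))
    {v : HeightOneSpectrum (𝓞 ℚ)} (hv : (primesEquiv v : ℕ) = 3)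
    {𝔓 : Ideal (absIntegers (𝓞 ℚ) ℚ)}
    (hmem : ∀ x : absIntegers (𝓞 ℚ) ℚ, x ∈ 𝔓 ↔ (x : AlgebraicClosure ℚ) ∈ (placeOver 3).nonunits)
    (h𝔓 : 𝔓 ∈ v.primesAbove) :
    3 ∣ Nat.card ((𝔓.inertia (absoluteGaloisGroup ℚ)).map (galoisRepTorsion W 3)) := by
  by_contra h3
  exact hnot (ClassX4.towerSurj_three_of_surj_of_tameTorsion hX hsurj hv hmem h𝔓 h3)

end WildTorsion

/-! ### The X4 end-state with the EXOTIC piece on the wild-`E[3]` rows only -/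

/-- **The EXOTIC hypothesis RESTRICTED to wild `3`-torsion at `3`.**  p251574's EXOTIC piece is
EQUIVALENT to the same statement on the rows with `3 ∣ #ρ̄_{E,3}(I_𝔓)` for all place data `(v, 𝔓)`
at `3`. [cite: Wuthrich2014, Lemma 20 (p. 399)] [cite: SerreAbelianLadic1968, Ch. IV §3.4, Lemma 3 (IV-23)]
[cite: SerreLocalFields1979, Ch. I §7 Cor. to Prop. 21 and Prop. 22(b)] -/
theorem exotic_iff_exotic_of_wildTorsion :
    (∀ (W : WeierstrassCurve ℚ) [W.IsElliptic] [W.IsGloballyMinimal],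
        W.analyticRank = 0 → ClassX4 W 3 → Surj W 3 → 0 ≤ padicValRat 3 W.j → ¬ TypeG W 3 →
        ¬ (∀ n : ℕ, W.HasSurjectiveModNGaloisRep (3 ^ n : ℕ)) → MissingUpperBoundAt W 3) ↔
    (∀ (W : WeierstrassCurve ℚ) [W.IsElliptic] [W.IsGloballyMinimal],
        W.analyticRank = 0 → ClassX4 W 3 → Surj W 3 → 0 ≤ padicValRat 3 W.j → ¬ TypeG W 3 →
        (∀ (v : HeightOneSpectrum (𝓞 ℚ)), (primesEquiv v : ℕ) = 3 →
          ∀ (𝔓 : Ideal (absIntegers (𝓞 ℚ) ℚ)),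
            (∀ x : absIntegers (𝓞 ℚ) ℚ, x ∈ 𝔓 ↔ (x : AlgebraicClosure ℚ) ∈ (placeOver 3).nonunits) →
            𝔓 ∈ v.primesAbove →
            3 ∣ Nat.card ((𝔓.inertia (absoluteGaloisGroup ℚ)).map (galoisRepTorsion W 3))) →
        ¬ (∀ n : ℕ, W.HasSurjectiveModNGaloisRep (3 ^ n : ℕ)) → MissingUpperBoundAt W 3) := by
  haveI : Fact (Nat.Prime 3) := ⟨Nat.prime_three⟩
  constructor
  · intro h V _ _ hr hX hs hj hG _ hnot
    exact h V hr hX hs hj hG hnot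
  · intro h V _ _ hr hX hs hj hG hnot
    exact h V hr hX hs hj hG
      (fun v hv 𝔓 hmem h𝔓 ↦ ClassX4.wildTorsion_of_not_towerSurj_three hX hs hnot hv hmem h𝔓) hnot

/-- **THE END-STATE OF CLASS X4 ON EIGHT NAMED FACTS with the EXOTIC piece on the WILD-`E[3]`
rows only: X4♯(unit-free) ⟺ LOWER ∧ EXOTIC(`ord₃ j ≥ 0` ∧ `¬ TypeG` ∧ `3 ∣ #ρ̄₃(I_𝔓)`) ∧
TAM-DEFECT₂♭ ∧ ODD-SHA♭ ∧ MANIN♭** — p251574's `…exoticTypeG_noL20` rewritten along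
`exotic_iff_exotic_of_wildTorsion`.  No named fact beyond the eight; X4 stays CONSTRUCTION-SHAPED;
nothing booked. [cite: Kato2004Asterisque, Thm. 14.5 (3) (p. 236), Thm. 17.4 (3) (p. 273)]
[cite: Delbourgo1998, Prop. 4 (p. 144)] [cite: Wuthrich2014, Lemma 20 (p. 399)] [cite: SilvermanAEC2009, Thm. X.4.14]
[cite: Kim2022StructureSelmer, Conj. 1.10 (PDF p. 8)] [cite: Miller2011LMS, Def. 1.1]
[cite: SerreLocalFields1979, Ch. I §7 Cor. to Prop. 21 and Prop. 22(b)] -/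
theorem x4SharpUnitFree_iff_lower_and_residues_sharp_exoticWildTorsion_noL20
    (hCT : exists_casselsTate_pairing (K := ℚ))
    (hKatoS : Kato2004.rankZero_padicValNat_sha_le_sub_localTamagawa_of_additive_potGood_of_imageContainsSL2)
    (hDel : Delbourgo1998.prop4_rankZero_pow_dvd_constantCoeff)
    (hGZK : rank_eq_analyticRank_of_analyticRank_le_one) (hmod : hasEntireLFunction_rat)
    (hmodD : nonempty_modularParametrizationData)
    (hKatoχ : Wuthrich2014.kato_halfEigenCharIdeal_dvd_cyclotomicPrime_of_surjective)
    (hK : Kato2004.charIdeal_dvd_padicLFunctionBranch_component_of_surjective) :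
    X4SharpUnitFree ↔
      (∀ (W : WeierstrassCurve ℚ) [W.IsElliptic] [W.IsGloballyMinimal] (p : ℕ) [Fact p.Prime],
          W.analyticRank = 0 → ClassX4 W p → Surj W p → MissingLowerBoundAt W p) ∧
      (∀ (W : WeierstrassCurve ℚ) [W.IsElliptic] [W.IsGloballyMinimal],
          W.analyticRank = 0 → ClassX4 W 3 → Surj W 3 → 0 ≤ padicValRat 3 W.j → ¬ TypeG W 3 →
          (∀ (v : HeightOneSpectrum (𝓞 ℚ)), (primesEquiv v : ℕ) = 3 →
            ∀ (𝔓 : Ideal (absIntegers (𝓞 ℚ) ℚ)),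
              (∀ x : absIntegers (𝓞 ℚ) ℚ, x ∈ 𝔓 ↔ (x : AlgebraicClosure ℚ) ∈ (placeOver 3).nonunits) →
              𝔓 ∈ v.primesAbove →
              3 ∣ Nat.card ((𝔓.inertia (absoluteGaloisGroup ℚ)).map (galoisRepTorsion W 3))) →
          ¬ (∀ n : ℕ, W.HasSurjectiveModNGaloisRep (3 ^ n : ℕ)) → MissingUpperBoundAt W 3) ∧
      (∀ (W : WeierstrassCurve ℚ) [W.IsElliptic] [W.IsGloballyMinimal] (p : ℕ) [Fact p.Prime],
          W.analyticRank = 0 → ClassX4 W p → Surj W p → 0 ≤ padicValRat p W.j →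
          ¬ (TypeGOrd W p ∧ semistabilityIndex W p = 2) →
          padicValNat p ((W.baseChange ℚ_[p]).localTamagawaNumber ℤ_[p]) + 2 ≤
            padicValNat p W.tamagawaProduct →
          MissingUpperBoundAt W p) ∧
      (∀ (W : WeierstrassCurve ℚ) [W.IsElliptic] [W.IsGloballyMinimal] (p : ℕ) [Fact p.Prime],
          W.analyticRank = 0 → ClassX4 W p → Surj W p → 0 ≤ padicValRat p W.j →
          ¬ (TypeGOrd W p ∧ semistabilityIndex W p = 2) →
          (∃ q : ℚ, shaAn W = (q : ℂ) ∧ Odd (padicValRat p q)) → MissingUpperBoundAt W p) ∧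
      (∀ (W : WeierstrassCurve ℚ) [W.IsElliptic] [W.IsGloballyMinimal] (p : ℕ) [Fact p.Prime],
          W.analyticRank = 0 → ClassX4 W p → Surj W p → 0 ≤ padicValRat p W.j →
          ¬ (TypeGOrd W p ∧ semistabilityIndex W p = 2) →
          (∀ (N : ℕ) [NeZero N] (D : ModularParametrizationData W N), (p : ℤ) ∣ D.maninConstant) →
          MissingUpperBoundAt W p) := by
  rw [x4SharpUnitFree_iff_lower_and_residues_sharp_exoticTypeG_noL20 hCT hKatoS hDel hGZK hmod hmodD
    hKatoχ hK, exotic_iff_exotic_of_wildTorsion]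

end Summit.BirchSwinnertonDyer.Rank1Residual.Additive

end
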